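import Mathlib.Data.Finset.Powerset
import Mathlib.Data.Fintype.Powerset
import Mathlib.Data.Fintype.Card
import Mathlib.Algebra.BigOperators.Group.Finset.Basic
import Mathlib.Data.Nat.Choose.Sum
import Mathlib.Tactic.Linarith

/-!
# `NoHeavyLowerTail` (crux stmt-CriticalPhenomena-4575), lane prim-ineq-gen-4 (gen 18): the counting condition `COND(α,k)` of
# `threshold_counting` / `threePartN_threshold_nonneg` in closed numeric form

Support file (`--supports stmt-CriticalPhenomena-4575`; memo `run/shared/lean/prim/prim-ineq-gen-4/PROOFS-RAB-ALL-K-g18.md` §8b).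
No definitions, no `sorry`, standard axioms.

`card_supersets_eq_choose`: `#{Y ⊇ u : #Y = #u + j} = C(card α − #u, j)`; `card_supersets_eq_sum`, `card_smallSets_eq_sum`: the counts in
`COND(α,k)` as binomial sums; `cond_of_numeric`: `COND(α,k)` follows from the purely numeric inequality (`n = card α`), for each `1 ≤ j < k`,
`(Σ_{1≤i<k} C(n,i)) · Σ_{l} [j+l+3 ≤ 2k ∧ k ≤ n−j−l] C(n−j,l) ≤ Σ_{l} [2k ≤ j+l+1 ∧ k ≤ n−j−l] C(n−j,l)`,
which `decide` settles for concrete `(n,k)` (e.g. `(15,3)`, companion file) and which holds for all `n ≥ 5, 15, 27, 40, 52, 65, 78`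
(`k = 2,…,8`; memo §8b, tools-g18/n0.py).
-/

namespace Summit.CriticalPhenomena.PercolationContinuityZ3.Theorems.ThresholdRAB

open Finset

variable {α : Type*} [DecidableEq α] [Fintype α]

/-- Supersets of `u` of size `#u + j` are counted by `C(card α − #u, j)`. [folklore] -/
theorem card_supersets_eq_choose (u : Finset α) (j : ℕ) :
    #((univ : Finset (Finset α)).filter fun Y => u ⊆ Y ∧ #Y = #u + j) = (Fintype.card α - #u).choose j := by
  rw [← card_compl u, ← card_powersetCard j uᶜ]
  refine card_bij' (fun Y _ => Y \ u) (fun Z _ => Z ∪ u) (fun Y hY => ?_) (fun Z hZ => ?_) (fun Y hY => ?_) (fun Z hZ => ?_)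
  · rw [mem_filter] at hY
    rw [mem_powersetCard]
    refine ⟨fun x hx => ?_, ?_⟩
    · rw [mem_compl]; exact (mem_sdiff.1 hx).2
    · rw [card_sdiff_of_subset hY.2.1, hY.2.2]; omega
  · rw [mem_powersetCard] at hZ
    rw [mem_filter]
    have hdisj : Disjoint Z u := disjoint_left.2 fun x hx hxu => (mem_compl.1 (hZ.1 hx)) hxu
    refine ⟨mem_univ _, subset_union_right, ?_⟩
    rw [card_union_of_disjoint hdisj, hZ.2]; omega
  · rw [mem_filter] at hY
    exact sdiff_union_of_subset hY.2.1
  · rw [mem_powersetCard] at hZ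
    have hdisj : Disjoint Z u := disjoint_left.2 fun x hx hxu => (mem_compl.1 (hZ.1 hx)) hxu
    rw [union_sdiff_cancel_right hdisj]

/-- Supersets of `u` whose size satisfies a predicate, counted by a binomial sum over the excess size. [folklore] -/
theorem card_supersets_eq_sum (u : Finset α) (P : ℕ → Prop) [DecidablePred P] :
    #((univ : Finset (Finset α)).filter fun Y => P #Y ∧ u ⊆ Y)
      = ∑ j ∈ range (Fintype.card α - #u + 1), (if P (#u + j) then (Fintype.card α - #u).choose j else 0) := by
  rw [card_eq_sum_card_fiberwise (f := fun Y : Finset α => #Y - #u) (t := range (Fintype.card α - #u + 1))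
    (fun Y hY => by
      rw [mem_coe, mem_filter] at hY
      rw [mem_coe, mem_range]
      have := card_le_univ Y
      change #Y - #u < _
      omega)]
  refine sum_congr rfl fun j hj => ?_
  by_cases hP : P (#u + j)
  · rw [if_pos hP, ← card_supersets_eq_choose u j]
    congr 1; ext Y; simp only [mem_filter, mem_univ, true_and]
    constructor
    · rintro ⟨⟨hPY, huY⟩, hj'⟩
      have := card_le_card huY
      exact ⟨huY, by omega⟩
    · rintro ⟨huY, hc⟩
      refine ⟨⟨by rw [hc]; exact hP, huY⟩, by omega⟩
  · rw [if_neg hP, card_eq_zero, filter_eq_empty_iff]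
    intro Y hY hj'
    rw [mem_filter] at hY
    have := card_le_card hY.2.2
    change #Y - #u = j at hj'
    have hc : #Y = #u + j := by omega
    exact hP (hc ▸ hY.2.1)

/-- The small sets of the whole type: `#{u : 1 ≤ #u < k} = Σ_{1 ≤ i < k} C(card α, i)`. [folklore] -/
theorem card_smallSets_eq_sum (k : ℕ) :
    #((univ : Finset (Finset α)).filter fun u => 1 ≤ #u ∧ #u < k) = ∑ i ∈ Ico 1 k, (Fintype.card α).choose i := by
  have h := card_supersets_eq_sum (∅ : Finset α) (fun c => 1 ≤ c ∧ c < k)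
  simp only [card_empty, empty_subset, and_true, Nat.sub_zero, zero_add] at h
  rw [h]
  -- compare the two index sets
  rw [← sum_filter]
  have hset : (range (Fintype.card α + 1)).filter (fun j => 1 ≤ j ∧ j < k)
      = (Ico 1 k).filter (fun j => j ≤ Fintype.card α) := by
    ext j; simp only [mem_filter, mem_range, mem_Ico]; omega
  rw [hset, sum_filter]
  refine sum_congr rfl fun j hj => ?_
  by_cases hjn : j ≤ Fintype.card α
  · rw [if_pos hjn]
  · rw [if_neg hjn, Nat.choose_eq_zero_of_lt (by omega)]

/-- **Numeric form of the counting condition.**  If for every `1 ≤ j < k`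
`(Σ_{1≤i<k} C(n,i)) · Σ_{y} [y+3 ≤ 2k ∧ k ≤ n−y ∧ j ≤ y] C(n−j, y−j) ≤ Σ_{y} [2k ≤ y+1 ∧ k ≤ n−y ∧ j ≤ y] C(n−j, y−j)` (`n = card α`),
then `COND(α,k)` holds. [this work] -/
theorem cond_of_numeric (k : ℕ)
    (h : ∀ j, 1 ≤ j → j < k →
      (∑ i ∈ Ico 1 k, (Fintype.card α).choose i)
          * (∑ l ∈ range (Fintype.card α - j + 1),
              (if (j + l) + 3 ≤ 2 * k ∧ k ≤ Fintype.card α - (j + l) then (Fintype.card α - j).choose l else 0))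
        ≤ ∑ l ∈ range (Fintype.card α - j + 1),
              (if 2 * k ≤ (j + l) + 1 ∧ k ≤ Fintype.card α - (j + l) then (Fintype.card α - j).choose l else 0)) :
    ∀ u : Finset α, 1 ≤ #u → #u < k →
      #((univ : Finset (Finset α)).filter fun u' => 1 ≤ #u' ∧ #u' < k)
          * #((univ : Finset (Finset α)).filter fun Y => (#Y + 3 ≤ 2 * k ∧ k ≤ #Yᶜ) ∧ u ⊆ Y)
        ≤ #((univ : Finset (Finset α)).filter fun Y => (2 * k ≤ #Y + 1 ∧ k ≤ #Yᶜ) ∧ u ⊆ Y) := by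
  intro u hu1 huk
  have e1 : ((univ : Finset (Finset α)).filter fun Y => (#Y + 3 ≤ 2 * k ∧ k ≤ #Yᶜ) ∧ u ⊆ Y)
      = (univ : Finset (Finset α)).filter fun Y => (#Y + 3 ≤ 2 * k ∧ k ≤ Fintype.card α - #Y) ∧ u ⊆ Y := by
    ext Y; simp only [mem_filter, card_compl]
  have e2 : ((univ : Finset (Finset α)).filter fun Y => (2 * k ≤ #Y + 1 ∧ k ≤ #Yᶜ) ∧ u ⊆ Y)
      = (univ : Finset (Finset α)).filter fun Y => (2 * k ≤ #Y + 1 ∧ k ≤ Fintype.card α - #Y) ∧ u ⊆ Y := by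
    ext Y; simp only [mem_filter, card_compl]
  rw [e1, e2, card_smallSets_eq_sum, card_supersets_eq_sum u (fun c => c + 3 ≤ 2 * k ∧ k ≤ Fintype.card α - c),
    card_supersets_eq_sum u (fun c => 2 * k ≤ c + 1 ∧ k ≤ Fintype.card α - c)]
  exact h #u hu1 huk

end Summit.CriticalPhenomena.PercolationContinuityZ3.Theorems.ThresholdRAB
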